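import Literature.Combinatorics.Optimization.CompletelyPsdRank
import Mathlib.Analysis.CStarAlgebra.ContinuousFunctionalCalculus.Order
import Mathlib.Analysis.SpecialFunctions.ContinuousFunctionalCalculus.Rpow.Basic
import Mathlib.Analysis.VonNeumannAlgebra.Basic
import HarnessLib

/-!
# Gram factorizations by positive elements of a tracial von Neumann algebra (PSVW §6.1, printed generality)

Source: A. Prakash, J. Sikora, A. Varvitsiotis, Z. Wei, *Completely positive semidefinite rank*,
Math. Program. 171 (2018) 397–431 = arXiv:1604.07199 [PrakashEtAl2017], §6.1 "cpsd-graphs"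
(held text `paper:arxiv-1604.07199`, chunks p19–p21: the definition of a tracial von Neumann algebra
`(𝒩, τ)`, Remark 6.1, the notion of an `𝒩⁺`-factorization, Theorem 17 and Lemma 11).

`CompletelyPsdRank.lean` types and proves Theorem 17 and Lemma 11 for the ONE tracial algebra
`(M_d(ℂ), Tr)`, i.e. for `CS_+`-factorizations (`HasCpsdFactorization.exists_row_eq_mul_row`,
`PrakashEtAl2017_lemma11_holds : … ∧ ¬ IsCpsd (A_t − λ_t I)`), and records in its module docstring
that "Theorem 17 for general tracial von Neumann algebras" was NOT typed for want of Mathlib support.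
The printed statements, however, quantify over EVERY tracial von Neumann algebra:

* (p19–p20) "A tracial von Neumann algebra `(𝒩, τ)` consists of a von Neumann algebra `𝒩` equipped
  with a linear functional `τ : 𝒩 → ℂ` satisfying: (i) `τ(x*x) ≥ 0` for all `x ∈ 𝒩` and `τ(1) = 1`
  (ii) `τ(x*x) = 0 ⟹ x = 0` (iii) `τ(xy) = τ(yx)` for all `x, y ∈ 𝒩` and (iv) the restriction of `τ`
  to the unit ball is continuous with respect to the weak operator topology. An element `p ∈ 𝒩` is
  called positive if `p = x*x` for some `x ∈ 𝒩` … any `p ∈ 𝒩⁺` has a unique positive square root."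
* (p20) "We say that a matrix `X ∈ DNN^n` admits an `𝒩⁺`-factorization if there exist positive
  elements `{p_i} ⊆ 𝒩⁺` such that `X = (τ(p_i p_j))`."
* **Remark 6.1** (p20): for self-adjoint `x_i` and `X = (τ(x_i x_j))`, every `u ∈ Ker X` has
  `Σ_i u_i x_i = 0`; and `τ(pq) = 0` for positive `p, q` forces `pq = 0`.
* **Theorem 17** (p20): a sufficient condition (i)–(v) on Gram vectors `{u_i}` under which
  `Gram({u_i})` "does not admit an `𝒩⁺`-factorization for any tracial von Neumann algebra `(𝒩, τ)`".
* **Lemma 11** (p20–p21): for `t ≥ 2` the matrix `A_t − λ_t I` of the odd cycle `C_{2t+1}`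
  (`λ_t = 2cos(2πt/(2t+1))` its least eigenvalue) "is doubly-nonnegative, its support is `C_{2t+1}`,
  and it does not admit an `𝒩⁺`-factorization for any tracial von Neumann algebra `(𝒩, τ)`".

This file PROVES Remark 6.1, Theorem 17 and the `𝒩⁺`-clause of Lemma 11 in that generality, typed
over Mathlib's abstract C⋆-algebras: `A` is any unital C⋆-algebra with its positive cone
(`[CStarAlgebra A] [PartialOrder A] [StarOrderedRing A]`; positivity `0 ≤ p` is `p = x*x` for some
`x`, Mathlib's `CStarAlgebra.nonneg_iff_eq_star_mul_self`, and positive square roots are unique,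
`CFC.mul_self_eq_mul_self_iff`), and `τ : A →ₗ[ℂ] ℂ` is a FAITHFUL POSITIVE TRACE
(`IsFaithfulTrace τ`: (i) without the normalisation `τ(1) = 1`, (ii), (iii)). Every tracial von
Neumann algebra in the printed sense is such a pair (a von Neumann algebra is a unital C⋆-algebra —
Mathlib's `WStarAlgebra` — and (i)–(iii) are assumed verbatim), so the theorems below contain the
printed ones; the normalisation in (i) and the continuity (iv) play no role in Remark 6.1, Theorem 17
or Lemma 11 and are not assumed (dropping them only enlarges the class of pairs `(A, τ)` quantified
over). The specialisations to `[WStarAlgebra N]` are recorded as `…_vonNeumann` corollaries, and the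
tracial pair `(M_d(ℂ), Tr)` of `CS_+`-factorizations (the case treated in `CompletelyPsdRank.lean`) is
exhibited as an instance, so that `¬ IsCpsd (A_t − λ_t I)` is re-derived from the general Lemma 11.

Contents (all PROVED, no named facts):
* `IsFaithfulTrace` ((i)–(iii) without `τ(1) = 1`), `IsFaithfulTracialState` ((i)–(iii) verbatim,
  `extends IsFaithfulTrace`), `IsFaithfulTrace.smul` (positive rescaling), `HasTracialFactorization τ X`
  ("`X` admits an `A⁺`-factorization through `τ`"), `HasTracialFactorization.smul_trace`.
* Remark 6.1: `IsFaithfulTrace.trace_star_sum_mul_sum` (`τ((Σ w_i x_i)*(Σ w_i x_i)) = wᵀ X w`),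
  `IsFaithfulTrace.sum_smul_eq_zero_of_mulVec_eq_zero` (kernel vectors transfer),
  `IsFaithfulTrace.trace_mul_nonneg`, `IsFaithfulTrace.mul_eq_zero_of_trace_mul_eq_zero` (`τ(pq) = 0 ⇒ pq = 0`).
* An `A⁺`-factorizable matrix is doubly nonnegative: `HasTracialFactorization.symm`,
  `.entry_nonneg`, `.posSemidef`, `.isDnn` (the printed definition presupposes `X ∈ DNN`).
* Theorem 17, Gram-free kernel-vector form (the mechanism of the printed proof, exactly as in the
  `M_d(ℂ)` version `HasCpsdFactorization.exists_row_eq_mul_row`):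
  `HasTracialFactorization.exists_row_eq_mul_row`; Theorem 17 as printed (vectors `u_i`, index sets
  `I, J`, hypotheses (i)–(v)): `PrakashEtAl2017_thm17`, and `PrakashEtAl2017_thm17_vonNeumann`.
* Lemma 11, `𝒩⁺`-clause for every `(A, τ)`: `PrakashEtAl2017_lemma11_tracial` (with the DNN clause
  from `PrakashEtAl2017_lemma11_holds`: `PrakashEtAl2017_lemma11_general`), and
  `PrakashEtAl2017_lemma11_vonNeumann`.
* The tracial pair `(M_d(ℂ), Tr)` of `CS_+`-factorizations as an instance (Mathlib's
  `CStarMatrix (Fin d) (Fin d) ℂ`): `matrixTrace`, `isFaithfulTrace_matrixTrace`,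
  `isFaithfulTracialState_matrixTrace_normalised` (`d⁻¹Tr` is a faithful tracial state, `d ≥ 1`),
  `ofMatrix_nonneg_of_posSemidef`, `HasCpsdFactorization.hasTracialFactorization_matrixTrace`,
  `not_isCpsd_of_not_hasTracialFactorization_matrixTrace`, and the `¬ IsCpsd` clause of Lemma 11
  re-derived from the tracial statement, `PrakashEtAl2017_lemma11_not_isCpsd`.

NOT here: Remark 6.2 (by [BLP] there is ONE tracial von Neumann algebra through which every element
of `cl(CS_+)` factors, whence `A_t − λ_t I ∉ cl(CS_+^n)`) — it rests on the Burgdorf–Laurent–Piovesan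
ultraproduct algebra, not in Mathlib; Theorem 18 is `PrakashEtAl2017_thm18_holds`
(`CompletelyPositiveGraphs.lean`).
-/

noncomputable section

open Matrix Finset
open scoped ComplexOrder RealInnerProductSpace

namespace Literature.Combinatorics.Optimization

variable {A : Type*} [CStarAlgebra A] [PartialOrder A] [StarOrderedRing A]

/-! ### Tracial pairs `(A, τ)` and `A⁺`-factorizations -/

/-- **Faithful positive trace** on a unital C⋆-algebra `A` (PSVW p19–p20, conditions (i)–(iii) of a
tracial von Neumann algebra `(𝒩, τ)`, verbatim, for a linear functional `τ : A → ℂ`): (i) `τ(x*x) ≥ 0`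
for all `x`; (ii) `τ(x*x) = 0 ⟹ x = 0`; (iii) `τ(xy) = τ(yx)` for all `x, y`. The printed
normalisation `τ(1) = 1` of (i) and the weak-operator continuity (iv) are not recorded (they are not
used by Remark 6.1, Theorem 17, Lemma 11; omitting them enlarges the class of pairs).
[cite: PrakashEtAl2017, §6.1 (p19–p20)] -/
structure IsFaithfulTrace (τ : A →ₗ[ℂ] ℂ) : Prop where
  /-- (i) positivity: `τ(x*x) ≥ 0`. -/
  nonneg : ∀ x : A, 0 ≤ τ (star x * x)
  /-- (ii) faithfulness: `τ(x*x) = 0 ⟹ x = 0`. -/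
  faithful : ∀ x : A, τ (star x * x) = 0 → x = 0
  /-- (iii) traciality: `τ(xy) = τ(yx)`. -/
  tracial : ∀ x y : A, τ (x * y) = τ (y * x)

/-- **Tracial state, faithful** — conditions (i)–(iii) of PSVW's "tracial von Neumann algebra `(𝒩, τ)`"
VERBATIM, i.e. `IsFaithfulTrace` together with the normalisation `τ(1) = 1` of (i) (the weak-operator
continuity (iv) is not expressible for an abstract C⋆-algebra and is never used). Every result below is
proved for `IsFaithfulTrace` and applies through `IsFaithfulTracialState.toIsFaithfulTrace`.
[cite: PrakashEtAl2017, §6.1 (p19–p20)] -/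
structure IsFaithfulTracialState (τ : A →ₗ[ℂ] ℂ) : Prop extends IsFaithfulTrace τ where
  /-- (i), normalisation: `τ(1) = 1`. -/
  map_one : τ 1 = 1

omit [PartialOrder A] [StarOrderedRing A] in
/-- Positive rescalings of faithful positive traces are faithful positive traces (so an unnormalised
trace `τ` with `τ(1) ≠ 0` gives the tracial state `τ(1)⁻¹ τ`). [cite: PrakashEtAl2017, §6.1 (p19–p20)] -/
theorem IsFaithfulTrace.smul {τ : A →ₗ[ℂ] ℂ} (hτ : IsFaithfulTrace τ) {r : ℝ} (hr : 0 < r) :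
    IsFaithfulTrace (((r : ℝ) : ℂ) • τ) where
  nonneg x := by
    rw [LinearMap.smul_apply, smul_eq_mul]
    exact mul_nonneg (Complex.zero_le_real.mpr hr.le) (hτ.nonneg x)
  faithful x hx := by
    rw [LinearMap.smul_apply, smul_eq_mul] at hx
    rcases mul_eq_zero.mp hx with h | h
    · exact absurd (by exact_mod_cast h : r = 0) hr.ne'
    · exact hτ.faithful x h
  tracial x y := by
    rw [LinearMap.smul_apply, LinearMap.smul_apply, hτ.tracial]

/-- **`𝒩⁺`-factorization** (PSVW p20, verbatim): "a matrix `X` admits an `𝒩⁺`-factorization if there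
exist positive elements `{p_i}_{i=1}^n ⊆ 𝒩⁺` such that `X = (τ(p_i p_j))_{i,j}`." Here for a real
matrix `X`, positive elements `0 ≤ p_i` of `A` (= `x*x`, `CStarAlgebra.nonneg_iff_eq_star_mul_self`)
and a linear functional `τ`. For `(A, τ) = (M_d(ℂ), Tr)` this is `HasCpsdFactorization X d`.
[cite: PrakashEtAl2017, §6.1 (p20)] -/
def HasTracialFactorization {ι : Type*} (τ : A →ₗ[ℂ] ℂ) (X : Matrix ι ι ℝ) : Prop :=
  ∃ p : ι → A, (∀ i, 0 ≤ p i) ∧ ∀ i j, ((X i j : ℝ) : ℂ) = τ (p i * p j)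

/-! ### Remark 6.1: kernel vectors transfer to the factors; `τ(pq) = 0 ⇒ pq = 0` -/

omit [PartialOrder A] [StarOrderedRing A] in
/-- For self-adjoint `x_i` with `X_{ij} = τ(x_i x_j)` and a real vector `w`:
`τ((Σ_i w_i x_i)* (Σ_i w_i x_i)) = wᵀ X w` (the display of Remark 6.1, p20). [cite: PrakashEtAl2017, Remark 6.1 (p20)] -/
theorem trace_star_sum_mul_sum {ι : Type*} [Fintype ι] (τ : A →ₗ[ℂ] ℂ) {x : ι → A}
    (hx : ∀ i, IsSelfAdjoint (x i)) {X : Matrix ι ι ℝ} (hX : ∀ i j, ((X i j : ℝ) : ℂ) = τ (x i * x j))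
    (w : ι → ℝ) :
    τ (star (∑ i, ((w i : ℝ) : ℂ) • x i) * ∑ i, ((w i : ℝ) : ℂ) • x i) =
      (((w ⬝ᵥ (X *ᵥ w) : ℝ)) : ℂ) := by
  have hSh : star (∑ i, ((w i : ℝ) : ℂ) • x i) = ∑ i, ((w i : ℝ) : ℂ) • x i := by
    rw [star_sum]
    refine Finset.sum_congr rfl fun i _ => ?_
    rw [star_smul, (hx i).star_eq, Complex.star_def, Complex.conj_ofReal]
  rw [hSh, Finset.sum_mul, map_sum]
  have h1 : ∀ a, τ ((((w a : ℝ) : ℂ) • x a) * ∑ b, ((w b : ℝ) : ℂ) • x b) =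
      ∑ b, ((w a : ℝ) : ℂ) * (((w b : ℝ) : ℂ) * τ (x a * x b)) := by
    intro a
    rw [Finset.mul_sum, map_sum]
    refine Finset.sum_congr rfl fun b _ => ?_
    rw [smul_mul_assoc, mul_smul_comm, map_smul, map_smul, smul_eq_mul, smul_eq_mul]
  simp only [h1, ← hX]
  simp only [dotProduct, mulVec, Finset.mul_sum]
  push_cast
  exact Finset.sum_congr rfl fun a _ => Finset.sum_congr rfl fun b _ => by ring

namespace IsFaithfulTrace

variable {τ : A →ₗ[ℂ] ℂ}

omit [PartialOrder A] [StarOrderedRing A] in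
/-- **Remark 6.1, first half** (p20, verbatim): "Let `{x_i} ⊆ 𝒩` such that `x_i* = x_i` for all `i`
and set `X := (τ(x_i x_j))`. For any `u ∈ Ker X` we have that `Σ_i x_i u_i = 0`. Indeed,
`0 = u* X u = τ((Σ u_i x_i)* (Σ u_i x_i))`, which by (ii) implies `Σ u_i x_i = 0`." (Typed for real
kernel vectors `w`, `X w = 0`.) [cite: PrakashEtAl2017, Remark 6.1 (p20)] -/
theorem sum_smul_eq_zero_of_mulVec_eq_zero {ι : Type*} [Fintype ι] (hτ : IsFaithfulTrace τ)
    {x : ι → A} (hx : ∀ i, IsSelfAdjoint (x i)) {X : Matrix ι ι ℝ}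
    (hX : ∀ i j, ((X i j : ℝ) : ℂ) = τ (x i * x j)) {w : ι → ℝ} (hw : X *ᵥ w = 0) :
    ∑ i, ((w i : ℝ) : ℂ) • x i = 0 := by
  apply hτ.faithful
  rw [trace_star_sum_mul_sum τ hx hX w, hw, dotProduct_zero, Complex.ofReal_zero]

/-- For positive `p, q`: `τ(pq) = τ((√p√q)* (√p√q))` — the computation of Remark 6.1 ("let `p = a*a`
and `q = b*b` and note that `τ(pq) = τ(a*a b*b) = τ((ab*)* ab*)`"), with `a = √p`, `b = √q` the positive
square roots. [cite: PrakashEtAl2017, Remark 6.1 (p20)] -/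
theorem trace_mul_eq_of_nonneg (hτ : IsFaithfulTrace τ) {p q : A} (hp : 0 ≤ p) (hq : 0 ≤ q) :
    τ (p * q) = τ (star (CFC.sqrt p * CFC.sqrt q) * (CFC.sqrt p * CFC.sqrt q)) := by
  have ha : CFC.sqrt p * CFC.sqrt p = p := CFC.sqrt_mul_sqrt_self p hp
  have hb : CFC.sqrt q * CFC.sqrt q = q := CFC.sqrt_mul_sqrt_self q hq
  have hsa : star (CFC.sqrt p) = CFC.sqrt p := (IsSelfAdjoint.of_nonneg (CFC.sqrt_nonneg p)).star_eq
  have hsb : star (CFC.sqrt q) = CFC.sqrt q := (IsSelfAdjoint.of_nonneg (CFC.sqrt_nonneg q)).star_eq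
  rw [star_mul, hsa, hsb]
  conv_lhs => rw [← ha, ← hb]
  rw [show CFC.sqrt p * CFC.sqrt p * (CFC.sqrt q * CFC.sqrt q) =
      (CFC.sqrt p * CFC.sqrt p * CFC.sqrt q) * CFC.sqrt q by simp only [mul_assoc], hτ.tracial]
  simp only [mul_assoc]

/-- `τ(pq) ≥ 0` for positive `p, q` (condition (i) applied to `√p√q`). [cite: PrakashEtAl2017, Remark 6.1 (p20)] -/
theorem trace_mul_nonneg (hτ : IsFaithfulTrace τ) {p q : A} (hp : 0 ≤ p) (hq : 0 ≤ q) :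
    0 ≤ τ (p * q) := by
  rw [hτ.trace_mul_eq_of_nonneg hp hq]
  exact hτ.nonneg _

/-- **Remark 6.1, second half** (p20, verbatim): "if `τ(pq) = 0` where `p, q` are positive elements of
`𝒩` then we have that `pq = 0`. To see this let `p = a*a` and `q = b*b` and note that
`τ(pq) = τ(a*a b*b) = τ((ab*)* ab*) = 0` which by (ii) implies that `ab* = 0`. This shows that `pq = 0`."
[cite: PrakashEtAl2017, Remark 6.1 (p20)] -/
theorem mul_eq_zero_of_trace_mul_eq_zero (hτ : IsFaithfulTrace τ) {p q : A} (hp : 0 ≤ p) (hq : 0 ≤ q)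
    (h : τ (p * q) = 0) : p * q = 0 := by
  have h1 := hτ.trace_mul_eq_of_nonneg hp hq
  rw [h] at h1
  have hab : CFC.sqrt p * CFC.sqrt q = 0 := hτ.faithful _ h1.symm
  have ha : CFC.sqrt p * CFC.sqrt p = p := CFC.sqrt_mul_sqrt_self p hp
  have hb : CFC.sqrt q * CFC.sqrt q = q := CFC.sqrt_mul_sqrt_self q hq
  calc p * q = (CFC.sqrt p * CFC.sqrt p) * (CFC.sqrt q * CFC.sqrt q) := by rw [ha, hb]
    _ = CFC.sqrt p * (CFC.sqrt p * CFC.sqrt q) * CFC.sqrt q := by simp only [mul_assoc]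
    _ = 0 := by rw [hab, mul_zero, zero_mul]

/-- A positive element with `p² = 0` is zero (faithfulness applied to `p* p = p²`). [cite: PrakashEtAl2017, Remark 6.1 (p20)] -/
theorem eq_zero_of_mul_self_eq_zero (hτ : IsFaithfulTrace τ) {p : A} (hp : 0 ≤ p) (h : p * p = 0) :
    p = 0 := by
  apply hτ.faithful
  rw [(IsSelfAdjoint.of_nonneg hp).star_eq, h, map_zero]

end IsFaithfulTrace

/-! ### `A⁺`-factorizable matrices are doubly nonnegative -/

namespace HasTracialFactorization

variable {ι : Type*} {τ : A →ₗ[ℂ] ℂ} {X : Matrix ι ι ℝ}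

omit [StarOrderedRing A] in
/-- Symmetry `X_{ij} = X_{ji}` of an `A⁺`-factorizable matrix (traciality (iii)). [cite: PrakashEtAl2017, §6.1 (p20)] -/
theorem symm (hτ : IsFaithfulTrace τ) (h : HasTracialFactorization τ X) (i j : ι) : X i j = X j i := by
  obtain ⟨p, -, hX⟩ := h
  have h1 := hX i j
  rw [hτ.tracial, ← hX j i] at h1
  exact_mod_cast h1

/-- Entries `X_{ij} = τ(p_i p_j) ≥ 0` of an `A⁺`-factorizable matrix. [cite: PrakashEtAl2017, §6.1 (p20), Remark 6.1] -/
theorem entry_nonneg (hτ : IsFaithfulTrace τ) (h : HasTracialFactorization τ X) (i j : ι) :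
    0 ≤ X i j := by
  obtain ⟨p, hp, hX⟩ := h
  have h1 := hτ.trace_mul_nonneg (hp i) (hp j)
  rw [← hX i j] at h1
  exact_mod_cast h1

/-- An `A⁺`-factorizable matrix is positive semidefinite: `wᵀ X w = τ(S* S) ≥ 0`, `S = Σ w_i p_i`.
[cite: PrakashEtAl2017, §6.1 (p20), Remark 6.1] -/
theorem posSemidef [Fintype ι] (hτ : IsFaithfulTrace τ) (h : HasTracialFactorization τ X) :
    X.PosSemidef := by
  have hsymm := h.symm hτ
  obtain ⟨p, hp, hX⟩ := h
  rw [Matrix.posSemidef_iff_dotProduct_mulVec]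
  refine ⟨?_, fun w => ?_⟩
  · ext i j
    rw [conjTranspose_apply, star_trivial]
    exact hsymm j i
  · have h1 := trace_star_sum_mul_sum τ (fun i => IsSelfAdjoint.of_nonneg (hp i)) hX w
    have h2 : 0 ≤ τ (star (∑ i, ((w i : ℝ) : ℂ) • p i) * ∑ i, ((w i : ℝ) : ℂ) • p i) := hτ.nonneg _
    rw [h1] at h2
    rw [star_trivial]
    exact_mod_cast h2

/-- An `A⁺`-factorizable matrix is doubly nonnegative ("a matrix `X ∈ DNN^n` admits an
`𝒩⁺`-factorization if …", p20: the class is a subclass of `DNN`). [cite: PrakashEtAl2017, §6.1 (p20)] -/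
theorem isDnn [Fintype ι] (hτ : IsFaithfulTrace τ) (h : HasTracialFactorization τ X) : IsDnn X :=
  ⟨h.posSemidef hτ, h.entry_nonneg hτ⟩

/-! ### Theorem 17 (every tracial pair `(A, τ)`): the kernel-vector mechanism -/

/-- **PSVW Theorem 17 for an arbitrary tracial pair `(A, τ)`, Gram-free form** (the printed proof,
p20). Let `X_{ab} = τ(p_a p_b)` with `p_a ∈ A⁺`. Suppose `w, w'` are real kernel vectors of `X` with
`w_i ≠ 0`, `w'_j ≠ 0` such that every further index `a ∉ {i, j}` in the support of `w` (resp. `w'`) has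
`X_{ja} = 0` (resp. `X_{ai} = 0`), and `X_{ij} ≠ 0`. Then row `j` of `X` is a POSITIVE multiple of row
`i`. Printed mechanism: `p_i ∈ span{p_a}` (Remark 6.1), pre- and post-multiplication by `p_j`, `p_i` kills
the orthogonal terms (`τ(pq) = 0 ⇒ pq = 0`), whence `p_j² = c·p_i²` with `c > 0` and, "since each
positive element of a C⋆-algebra has a unique positive square root", `p_j = √c·p_i`. (Hypotheses
(i)–(iii) of the printed statement produce such `w, w'` from Gram vectors, (v) is `X_{ij} ≠ 0`, and the
conclusion contradicts (iv); see `PrakashEtAl2017_thm17`. The case `(A, τ) = (M_d(ℂ), Tr)` is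
`HasCpsdFactorization.exists_row_eq_mul_row`.) [cite: PrakashEtAl2017, Thm. 17 (p20), Remark 6.1 (p20)] -/
theorem exists_row_eq_mul_row [Fintype ι] [DecidableEq ι] (hτ : IsFaithfulTrace τ)
    (hXf : HasTracialFactorization τ X) {i j : ι}
    {w w' : ι → ℝ} (hw : X *ᵥ w = 0) (hw' : X *ᵥ w' = 0) (hwi : w i ≠ 0) (hw'j : w' j ≠ 0)
    (hJ : ∀ a, a ≠ i → a ≠ j → w a = 0 ∨ X j a = 0)
    (hI : ∀ a, a ≠ i → a ≠ j → w' a = 0 ∨ X a i = 0) (hXij : X i j ≠ 0) :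
    ∃ c : ℝ, 0 < c ∧ ∀ b, X j b = c * X i b := by
  classical
  have hXsymm : ∀ a b, X a b = X b a := hXf.symm hτ
  obtain ⟨P, hP, hX⟩ := hXf
  by_cases hij : i = j
  · subst hij
    exact ⟨1, one_pos, fun b => by rw [one_mul]⟩
  -- `τ(P_a P_b) = 0 ⇒ P_a P_b = 0`
  have hperp : ∀ a b, X a b = 0 → P a * P b = 0 := fun a b h =>
    hτ.mul_eq_zero_of_trace_mul_eq_zero (hP a) (hP b) (by rw [← hX, h, Complex.ofReal_zero])
  -- the two kernel relations
  have hS := hτ.sum_smul_eq_zero_of_mulVec_eq_zero (fun a => IsSelfAdjoint.of_nonneg (hP a)) hX hw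
  have hS' := hτ.sum_smul_eq_zero_of_mulVec_eq_zero (fun a => IsSelfAdjoint.of_nonneg (hP a)) hX hw'
  -- pre-multiply the first by `P_j`: only `a = i, j` survive
  have hE1 : ((w i : ℝ) : ℂ) • (P j * P i) + ((w j : ℝ) : ℂ) • (P j * P j) = 0 := by
    have h := congrArg (fun M => P j * M) hS
    simp only [Finset.mul_sum, mul_smul_comm, mul_zero] at h
    rw [← Finset.sum_subset (Finset.subset_univ ({i, j} : Finset ι))] at h
    · rwa [Finset.sum_pair hij] at h
    · intro a _ ha
      rw [Finset.mem_insert, Finset.mem_singleton, not_or] at ha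
      rcases hJ a ha.1 ha.2 with h0 | h0
      · rw [h0, Complex.ofReal_zero, zero_smul]
      · rw [hperp j a h0, smul_zero]
  -- post-multiply the second by `P_i`
  have hE2 : ((w' i : ℝ) : ℂ) • (P i * P i) + ((w' j : ℝ) : ℂ) • (P j * P i) = 0 := by
    have h := congrArg (fun M => M * P i) hS'
    simp only [Finset.sum_mul, smul_mul_assoc, zero_mul] at h
    rw [← Finset.sum_subset (Finset.subset_univ ({i, j} : Finset ι))] at h
    · rwa [Finset.sum_pair hij] at h
    · intro a _ ha
      rw [Finset.mem_insert, Finset.mem_singleton, not_or] at ha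
      rcases hI a ha.1 ha.2 with h0 | h0
      · rw [h0, Complex.ofReal_zero, zero_smul]
      · rw [hperp a i h0, smul_zero]
  -- `P_j P_i ≠ 0`, hence `w_j ≠ 0`, `w'_i ≠ 0`, `P_i² ≠ 0`, `P_j² ≠ 0`
  have hM : P j * P i ≠ 0 := by
    intro h0
    apply hXij
    rw [hXsymm]
    have h1 := hX j i
    rw [h0, map_zero] at h1
    exact_mod_cast h1
  have hwj : w j ≠ 0 := by
    intro h0
    rw [h0, Complex.ofReal_zero, zero_smul, add_zero, smul_eq_zero] at hE1
    rcases hE1 with h1 | h1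
    · exact hwi (by exact_mod_cast h1)
    · exact hM h1
  have hw'i : w' i ≠ 0 := by
    intro h0
    rw [h0, Complex.ofReal_zero, zero_smul, zero_add, smul_eq_zero] at hE2
    rcases hE2 with h1 | h1
    · exact hw'j (by exact_mod_cast h1)
    · exact hM h1
  -- `P_j² = α · P_jP_i`, `P_i² = β · P_jP_i`
  set α : ℝ := -(w i / w j) with hα
  set β : ℝ := -(w' j / w' i) with hβ
  have hPj : P j * P j = ((α : ℝ) : ℂ) • (P j * P i) := by
    have hwjC : ((w j : ℝ) : ℂ) ≠ 0 := by exact_mod_cast hwj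
    have h1 : ((w j : ℝ) : ℂ) • (P j * P j) = -(((w i : ℝ) : ℂ) • (P j * P i)) :=
      eq_neg_of_add_eq_zero_right hE1
    calc P j * P j = (((w j : ℝ) : ℂ))⁻¹ • (((w j : ℝ) : ℂ) • (P j * P j)) := by
          rw [smul_smul, inv_mul_cancel₀ hwjC, one_smul]
      _ = ((α : ℝ) : ℂ) • (P j * P i) := by
          rw [h1, smul_neg, smul_smul, ← neg_smul]
          have e : -((((w j : ℝ) : ℂ))⁻¹ * ((w i : ℝ) : ℂ)) = ((α : ℝ) : ℂ) := by
            rw [hα]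
            push_cast
            ring
          rw [e]
  have hPi : P i * P i = ((β : ℝ) : ℂ) • (P j * P i) := by
    have hwiC : ((w' i : ℝ) : ℂ) ≠ 0 := by exact_mod_cast hw'i
    have h1 : ((w' i : ℝ) : ℂ) • (P i * P i) = -(((w' j : ℝ) : ℂ) • (P j * P i)) :=
      eq_neg_of_add_eq_zero_left hE2
    calc P i * P i = (((w' i : ℝ) : ℂ))⁻¹ • (((w' i : ℝ) : ℂ) • (P i * P i)) := by
          rw [smul_smul, inv_mul_cancel₀ hwiC, one_smul]
      _ = ((β : ℝ) : ℂ) • (P j * P i) := by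
          rw [h1, smul_neg, smul_smul, ← neg_smul]
          have e : -((((w' i : ℝ) : ℂ))⁻¹ * ((w' j : ℝ) : ℂ)) = ((β : ℝ) : ℂ) := by
            rw [hβ]
            push_cast
            ring
          rw [e]
  -- `P_i ≠ 0`, `P_j ≠ 0`, so `β ≠ 0`, `α ≠ 0`, and the diagonal entries are positive
  have hPsq_ne : ∀ a, P a * P i ≠ 0 ∨ P j * P a ≠ 0 → P a * P a ≠ 0 := by
    intro a ha h0
    have hPa : P a = 0 := hτ.eq_zero_of_mul_self_eq_zero (hP a) h0
    rcases ha with ha | ha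
    · exact ha (by rw [hPa, zero_mul])
    · exact ha (by rw [hPa, mul_zero])
  have hPii : P i * P i ≠ 0 := hPsq_ne i (Or.inr hM)
  have hPjj : P j * P j ≠ 0 := hPsq_ne j (Or.inl hM)
  have hβ0 : β ≠ 0 := by
    intro h0
    rw [h0, Complex.ofReal_zero, zero_smul] at hPi
    exact hPii hPi
  have hα0 : α ≠ 0 := by
    intro h0
    rw [h0, Complex.ofReal_zero, zero_smul] at hPj
    exact hPjj hPj
  -- `P_j² = c · P_i²`, `c = α/β`
  set c : ℝ := α / β with hc
  have hPjc : P j * P j = ((c : ℝ) : ℂ) • (P i * P i) := by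
    rw [hPi, smul_smul, hPj]
    have e : ((α : ℝ) : ℂ) = ((c : ℝ) : ℂ) * ((β : ℝ) : ℂ) := by
      rw [hc]
      have hβC : ((β : ℝ) : ℂ) ≠ 0 := by exact_mod_cast hβ0
      push_cast
      rw [div_mul_cancel₀ _ hβC]
    rw [e]
  have hXii_pos : 0 < X i i := by
    have h0 : 0 ≤ X i i := by
      have h1 := hτ.trace_mul_nonneg (hP i) (hP i)
      rw [← hX i i] at h1
      exact_mod_cast h1
    rcases h0.lt_or_eq with h0 | h0
    · exact h0
    · exfalso
      apply hPii
      apply hperp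
      exact h0.symm
  have hXjj_nn : 0 ≤ X j j := by
    have h1 := hτ.trace_mul_nonneg (hP j) (hP j)
    rw [← hX j j] at h1
    exact_mod_cast h1
  have hcXX : X j j = c * X i i := by
    have h := congrArg τ hPjc
    rw [map_smul, ← hX, ← hX, smul_eq_mul] at h
    exact_mod_cast h
  have hc_pos : 0 < c := by
    have hc0 : c ≠ 0 := div_ne_zero hα0 hβ0
    have hc_nn : 0 ≤ c := by
      by_contra hneg
      push Not at hneg
      have : X j j < 0 := by rw [hcXX]; exact mul_neg_of_neg_of_pos hneg hXii_pos
      linarith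
    exact lt_of_le_of_ne hc_nn (Ne.symm hc0)
  -- uniqueness of positive square roots: `P_j = √c · P_i`
  have hsq : P j * P j = (((Real.sqrt c : ℝ) : ℂ) • P i) * (((Real.sqrt c : ℝ) : ℂ) • P i) := by
    rw [smul_mul_assoc, mul_smul_comm, smul_smul, hPjc]
    congr 1
    rw [← Complex.ofReal_mul, Real.mul_self_sqrt hc_pos.le]
  have hPj_eq : P j = ((Real.sqrt c : ℝ) : ℂ) • P i := by
    have hsPi : 0 ≤ ((Real.sqrt c : ℝ) : ℂ) • P i := by
      rw [Complex.coe_smul]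
      exact smul_nonneg (Real.sqrt_nonneg c) (hP i)
    exact (CFC.mul_self_eq_mul_self_iff (P j) _ (hP j) hsPi).mp hsq
  refine ⟨Real.sqrt c, Real.sqrt_pos.mpr hc_pos, fun b => ?_⟩
  have h := hX j b
  rw [hPj_eq, smul_mul_assoc, map_smul, ← hX, smul_eq_mul] at h
  exact_mod_cast h

end HasTracialFactorization

/-! ### Theorem 17 as printed -/

/-- **PSVW Theorem 17** (p20, verbatim): "Consider nonzero vectors `{u_i}_{i=1}^n ⊆ ℝ^d` such that
`⟨u_i, u_j⟩ ≥ 0` for all `i, j ∈ [n]`. Assume that there exist subsets `I, J ⊆ [n]` with the following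
properties: (i) `span({u_i : i ∈ I}) = span({u_j : j ∈ J}) = span({u_i : i ∈ [n]})`; (ii) There exists
`i* ∈ I` such that `⟨u_{i*}, u_i⟩ = 0`, for all `i ∈ I ∖ {i*}`; (iii) There exists `j* ∈ J` such that
`⟨u_{j*}, u_j⟩ = 0`, for all `j ∈ J ∖ {j*}`; (iv) The vector `u_{i*}` is not parallel to `u_{j*}`;
(v) We have `⟨u_{i*}, u_{j*}⟩ ≠ 0`. Then the matrix `Gram({u_i}_{i=1}^n)` does not admit an
`𝒩⁺`-factorization for any tracial von Neumann algebra `(𝒩, τ)`." Typed for every unital C⋆-algebra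
`A` with a faithful positive trace `τ` (see the module docstring), index type `ι` for `[n]`, `i₀, j₀`
for `i*, j*`, "not parallel" as `u_{i*} ≠ c·u_{j*}` for every real `c`. PROVED by the printed argument:
(i) gives `u_{i*} = Σ_{j∈J} λ_j u_j` and `u_{j*} = Σ_{i∈I} μ_i u_i`, i.e. kernel vectors
`e_{i*} − λ`, `e_{j*} − μ` of the Gram matrix to which `HasTracialFactorization.exists_row_eq_mul_row`
applies ((ii), (iii), (v) kill the cross terms and force `i* ∉ J`, `j* ∉ I`); rows `i*, j*` of the Gram
matrix proportional makes `u_{j*} − c u_{i*}` orthogonal to every `u_b`, hence zero, contradicting (iv).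
(The hypotheses "`u_i ≠ 0`", "`⟨u_i,u_j⟩ ≥ 0`", `i* ∈ I`, `j* ∈ J` are carried verbatim but not used by
the proof.) [cite: PrakashEtAl2017, Thm. 17 (p20)] -/
theorem PrakashEtAl2017_thm17 {ι : Type*} [Fintype ι] [DecidableEq ι] {d : ℕ}
    (u : ι → EuclideanSpace ℝ (Fin d)) (_hu : ∀ i, u i ≠ 0) (_huu : ∀ i j, 0 ≤ ⟪u i, u j⟫)
    (I J : Finset ι)
    (hIJ : Submodule.span ℝ (u '' ↑I) = Submodule.span ℝ (Set.range u) ∧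
      Submodule.span ℝ (u '' ↑J) = Submodule.span ℝ (Set.range u))
    {i₀ : ι} (_hi₀ : i₀ ∈ I) (hI : ∀ i ∈ I, i ≠ i₀ → ⟪u i₀, u i⟫ = 0)
    {j₀ : ι} (_hj₀ : j₀ ∈ J) (hJ : ∀ j ∈ J, j ≠ j₀ → ⟪u j₀, u j⟫ = 0)
    (hpar : ∀ c : ℝ, u i₀ ≠ c • u j₀) (hne : ⟪u i₀, u j₀⟫ ≠ 0)
    (τ : A →ₗ[ℂ] ℂ) (hτ : IsFaithfulTrace τ) :
    ¬ HasTracialFactorization τ (Matrix.of fun i j => ⟪u i, u j⟫) := by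
  classical
  intro hX
  set X : Matrix ι ι ℝ := Matrix.of fun i j => ⟪u i, u j⟫ with hXdef
  have hXapply : ∀ a b, X a b = ⟪u a, u b⟫ := fun a b => rfl
  -- `i* ≠ j*`, `i* ∉ J`, `j* ∉ I`
  have hij : i₀ ≠ j₀ := by
    intro h
    exact hpar 1 (by rw [one_smul, h])
  have hi₀J : i₀ ∉ J := by
    intro h
    have h1 := hJ i₀ h hij
    rw [real_inner_comm] at h1
    exact hne h1
  have hj₀I : j₀ ∉ I := by
    intro h
    exact hne (hI j₀ h (Ne.symm hij))
  -- (i): coefficients `λ` supported on `J` with `u_{i*} = Σ λ_j u_j`, and `μ` supported on `I`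
  have hmemJ : u i₀ ∈ Submodule.span ℝ (u '' ↑J) := by
    rw [hIJ.2]
    exact Submodule.subset_span (Set.mem_range_self i₀)
  have hmemI : u j₀ ∈ Submodule.span ℝ (u '' ↑I) := by
    rw [hIJ.1]
    exact Submodule.subset_span (Set.mem_range_self j₀)
  obtain ⟨lam, hlamJ, hlam⟩ := (Finsupp.mem_span_image_iff_linearCombination ℝ).mp hmemJ
  obtain ⟨mu, hmuI, hmu⟩ := (Finsupp.mem_span_image_iff_linearCombination ℝ).mp hmemI
  have hlam_sum : ∑ b, lam b • u b = u i₀ := by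
    rw [← hlam, Finsupp.linearCombination_apply, Finsupp.sum_fintype]
    intro b
    exact zero_smul ℝ (u b)
  have hmu_sum : ∑ b, mu b • u b = u j₀ := by
    rw [← hmu, Finsupp.linearCombination_apply, Finsupp.sum_fintype]
    intro b
    exact zero_smul ℝ (u b)
  have hlam_out : ∀ b, b ∉ J → lam b = 0 := fun b hb =>
    Finsupp.notMem_support_iff.mp fun h => hb (hlamJ h)
  have hmu_out : ∀ b, b ∉ I → mu b = 0 := fun b hb =>
    Finsupp.notMem_support_iff.mp fun h => hb (hmuI h)
  -- the Gram matrix against a coefficient vector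
  have hGram : ∀ (v : ι → ℝ) (a : ι), (X *ᵥ v) a = ⟪u a, ∑ b, v b • u b⟫ := by
    intro v a
    rw [inner_sum]
    simp only [mulVec, dotProduct, hXapply, real_inner_smul_right]
    exact Finset.sum_congr rfl fun b _ => by ring
  -- kernel vectors `w = e_{i*} − λ`, `w' = e_{j*} − μ`
  set w : ι → ℝ := fun b => (if b = i₀ then 1 else 0) - lam b with hwdef
  set w' : ι → ℝ := fun b => (if b = j₀ then 1 else 0) - mu b with hw'def
  have hsingle : ∀ (k : ι), ∑ b, (if b = k then (1 : ℝ) else 0) • u b = u k := by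
    intro k
    rw [Finset.sum_eq_single k]
    · rw [if_pos rfl, one_smul]
    · intro b _ hb
      rw [if_neg hb, zero_smul]
    · intro h
      exact absurd (Finset.mem_univ k) h
  have hw : X *ᵥ w = 0 := by
    ext a
    rw [hGram, Pi.zero_apply]
    simp only [hwdef, sub_smul, Finset.sum_sub_distrib, hsingle, hlam_sum, sub_self, inner_zero_right]
  have hw' : X *ᵥ w' = 0 := by
    ext a
    rw [hGram, Pi.zero_apply]
    simp only [hw'def, sub_smul, Finset.sum_sub_distrib, hsingle, hmu_sum, sub_self, inner_zero_right]
  have hwi : w i₀ ≠ 0 := by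
    simp only [hwdef, if_true, hlam_out i₀ hi₀J, sub_zero]
    exact one_ne_zero
  have hw'j : w' j₀ ≠ 0 := by
    simp only [hw'def, if_true, hmu_out j₀ hj₀I, sub_zero]
    exact one_ne_zero
  have hJ' : ∀ a, a ≠ i₀ → a ≠ j₀ → w a = 0 ∨ X j₀ a = 0 := by
    intro a ha1 ha2
    by_cases haJ : a ∈ J
    · right
      rw [hXapply]
      exact hJ a haJ ha2
    · left
      simp only [hwdef, if_neg ha1, hlam_out a haJ, sub_zero]
  have hI' : ∀ a, a ≠ i₀ → a ≠ j₀ → w' a = 0 ∨ X a i₀ = 0 := by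
    intro a ha1 ha2
    by_cases haI : a ∈ I
    · right
      rw [hXapply, real_inner_comm]
      exact hI a haI ha1
    · left
      simp only [hw'def, if_neg ha2, hmu_out a haI, sub_zero]
  have hXij : X i₀ j₀ ≠ 0 := by rw [hXapply]; exact hne
  obtain ⟨c, hc, hrow⟩ := hX.exists_row_eq_mul_row hτ hw hw' hwi hw'j hJ' hI' hXij
  -- `u_{j*} − c u_{i*}` is orthogonal to every `u_b`, hence to itself
  set v : EuclideanSpace ℝ (Fin d) := u j₀ - c • u i₀ with hvdef
  have hv : ∀ b, ⟪v, u b⟫ = 0 := by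
    intro b
    have h := hrow b
    rw [hXapply, hXapply] at h
    rw [hvdef, inner_sub_left, real_inner_smul_left, h, sub_self]
  have hvv : ⟪v, v⟫ = 0 := by
    rw [hvdef, inner_sub_right, inner_smul_right, ← hvdef, hv j₀, hv i₀, mul_zero, sub_zero]
  have hv0 : v = 0 := inner_self_eq_zero.mp hvv
  apply hpar c⁻¹
  have h1 : u j₀ = c • u i₀ := by
    rw [← sub_eq_zero]
    exact hv0
  rw [h1, smul_smul, inv_mul_cancel₀ hc.ne', one_smul]

/-- **Theorem 17 for tracial von Neumann algebras**, the printed scope: the statement of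
`PrakashEtAl2017_thm17` for a von Neumann algebra `N` (Mathlib's `WStarAlgebra`: a unital C⋆-algebra
with a predual) with a faithful positive trace. [cite: PrakashEtAl2017, Thm. 17 (p20)] -/
theorem PrakashEtAl2017_thm17_vonNeumann {N : Type*} [CStarAlgebra N] [WStarAlgebra N] [PartialOrder N]
    [StarOrderedRing N] {ι : Type*} [Fintype ι] [DecidableEq ι] {d : ℕ}
    (u : ι → EuclideanSpace ℝ (Fin d)) (hu : ∀ i, u i ≠ 0) (huu : ∀ i j, 0 ≤ ⟪u i, u j⟫)
    (I J : Finset ι)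
    (hIJ : Submodule.span ℝ (u '' ↑I) = Submodule.span ℝ (Set.range u) ∧
      Submodule.span ℝ (u '' ↑J) = Submodule.span ℝ (Set.range u))
    {i₀ : ι} (hi₀ : i₀ ∈ I) (hI : ∀ i ∈ I, i ≠ i₀ → ⟪u i₀, u i⟫ = 0)
    {j₀ : ι} (hj₀ : j₀ ∈ J) (hJ : ∀ j ∈ J, j ≠ j₀ → ⟪u j₀, u j⟫ = 0)
    (hpar : ∀ c : ℝ, u i₀ ≠ c • u j₀) (hne : ⟪u i₀, u j₀⟫ ≠ 0)
    (τ : N →ₗ[ℂ] ℂ) (hτ : IsFaithfulTrace τ) :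
    ¬ HasTracialFactorization τ (Matrix.of fun i j => ⟪u i, u j⟫) :=
  PrakashEtAl2017_thm17 u hu huu I J hIJ hi₀ hI hj₀ hJ hpar hne τ hτ

/-! ### Lemma 11 for every tracial pair `(A, τ)` -/

section Lemma11

open Real
open Fin.CommRing

variable {m : ℕ}

/-- Adjacency in the cycle graph `C_{m+2}`: `a ∼ b` iff `a = b ± 1`. [folklore] -/
private theorem cycleGraph_adj_iff' (a b : Fin (m + 2)) :
    (SimpleGraph.cycleGraph (m + 2)).Adj a b ↔ a = b + 1 ∨ b = a + 1 := by
  rw [SimpleGraph.cycleGraph_adj, sub_eq_iff_eq_add, sub_eq_iff_eq_add, add_comm (1 : Fin (m + 2)) b,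
    add_comm (1 : Fin (m + 2)) a]

/-- `(A(C_n) w)_v = w_{v−1} + w_{v+1}` for `n = m + 2 ≥ 3`. [folklore] -/
private theorem cycle_adjMatrix_mulVec' (hm : 1 ≤ m) (w : Fin (m + 2) → ℝ) (v : Fin (m + 2)) :
    ((SimpleGraph.cycleGraph (m + 2)).adjMatrix ℝ *ᵥ w) v = w (v - 1) + w (v + 1) := by
  rw [SimpleGraph.adjMatrix_mulVec_apply, SimpleGraph.cycleGraph_neighborFinset, Finset.sum_pair]
  intro h
  have h2 : (1 : Fin (m + 2)) + 1 = 0 := by linear_combination (-1 : Fin (m + 2)) * h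
  have h3 := congrArg Fin.val h2
  rw [Fin.val_add, Fin.val_one, Fin.val_zero, Nat.mod_eq_of_lt (by omega)] at h3
  omega

/-- For `θ` with `θ·n ∈ 2πℤ`, the vector `k ↦ sin(θk + φ)` lies in the kernel of `A(C_n) − 2cos θ·I`
("`λ_t = 2cos(2πt/(2t+1))` with multiplicity `2`", p21). [cite: PrakashEtAl2017, Lemma 11 proof (p21)] -/
private theorem cycle_sub_mulVec_sin' (hm : 1 ≤ m) (θ φ : ℝ) (t : ℕ) (hθ : θ * (m + 2 : ℕ) = 2 * π * t) :
    ((SimpleGraph.cycleGraph (m + 2)).adjMatrix ℝ -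
        (2 * Real.cos θ) • (1 : Matrix (Fin (m + 2)) (Fin (m + 2)) ℝ)) *ᵥ
      (fun k : Fin (m + 2) => Real.sin (θ * k + φ)) = 0 := by
  -- the periodic extension `g(x) = sin(θx + φ)`, `g(x + n) = g(x)`
  set g : ℝ → ℝ := fun x => Real.sin (θ * x + φ) with hg
  have hper : ∀ x, g (x + (m + 2 : ℕ)) = g x := by
    intro x
    simp only [hg]
    rw [mul_add, hθ, show θ * x + 2 * π * t + φ = θ * x + φ + t * (2 * π) by ring,
      Real.sin_add_nat_mul_two_pi]
  have hsucc : ∀ v : Fin (m + 2), g ((v + 1 : Fin (m + 2)) : ℕ) = g ((v : ℕ) + 1) := by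
    intro v
    rw [Fin.val_add_one]
    split_ifs with hv
    · rw [hv, Fin.val_last, ← hper ((0 : ℕ) : ℝ)]
      congr 1
      push_cast
      ring
    · push_cast
      rfl
  have hpred : ∀ v : Fin (m + 2), g ((v - 1 : Fin (m + 2)) : ℕ) = g ((v : ℕ) - 1) := by
    intro v
    rw [Fin.coe_sub_one]
    split_ifs with hv
    · rw [hv, Fin.val_zero, ← hper (((0 : ℕ) : ℝ) - 1)]
      congr 1
      push_cast
      ring
    · have h1 : 1 ≤ (v : ℕ) := by
        rcases Nat.eq_zero_or_pos (v : ℕ) with h | h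
        · exact absurd (Fin.ext h) hv
        · exact h
      rw [Nat.cast_sub h1, Nat.cast_one]
  ext v
  rw [sub_mulVec, Pi.sub_apply, cycle_adjMatrix_mulVec' hm, smul_mulVec, one_mulVec, Pi.zero_apply,
    Pi.smul_apply, smul_eq_mul]
  have e1 : Real.sin (θ * ((v - 1 : Fin (m + 2)) : ℕ) + φ) = g ((v : ℕ) - 1) := hpred v
  have e2 : Real.sin (θ * ((v + 1 : Fin (m + 2)) : ℕ) + φ) = g ((v : ℕ) + 1) := hsucc v
  rw [e1, e2]
  simp only [hg]
  have key : ∀ U : ℝ, Real.sin (U - θ) + Real.sin (U + θ) - 2 * Real.cos θ * Real.sin U = 0 := by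
    intro U
    rw [Real.sin_sub, Real.sin_add]
    ring
  have e3 : θ * ((v : ℕ) - 1 : ℝ) + φ = (θ * ((v : ℕ) : ℝ) + φ) - θ := by ring
  have e4 : θ * ((v : ℕ) + 1 : ℝ) + φ = (θ * ((v : ℕ) : ℝ) + φ) + θ := by ring
  rw [e3, e4]
  linarith [key (θ * ((v : ℕ) : ℝ) + φ)]

/-- **Lemma 11 on `Fin (m+2)`, `m + 2 = 2t + 1`, `t ≥ 2`, for a tracial pair `(A, τ)`**: no
`A⁺`-factorization of `A(C_{2t+1}) − λ_t I`. The printed proof: Theorem 17 with `i* = 1`, `j* = 2`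
((iv) is `det X[1,2] = λ_t² − 1 ≠ 0`, (v) is `⟨u_1,u_2⟩ = 1`); here through the Gram-free form with the
kernel vectors `w_k = sin(θ(k − 2))`, `w'_k = sin(θ(k + 1))`, `θ = 2πt/n` (as in the `M_d(ℂ)` proof of
`PrakashEtAl2017_lemma11_holds`): rows `0, 1` proportional gives `λ_t² = 1`, but `λ_t < −1`.
[cite: PrakashEtAl2017, Lemma 11 (p20–p21), Thm. 17 (p20)] -/
private theorem lemma11_tracial_core (m t : ℕ) (ht : 2 ≤ t) (hm : m + 2 = 2 * t + 1)
    (τ : A →ₗ[ℂ] ℂ) (hτ : IsFaithfulTrace τ) :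
    ¬ HasTracialFactorization τ ((SimpleGraph.cycleGraph (m + 2)).adjMatrix ℝ -
        (2 * Real.cos (2 * Real.pi * t / (2 * t + 1))) • (1 : Matrix (Fin (m + 2)) (Fin (m + 2)) ℝ)) := by
  classical
  have hm1 : 1 ≤ m := by omega
  have hnR : ((m + 2 : ℕ) : ℝ) = 2 * t + 1 := by exact_mod_cast hm
  set θ : ℝ := 2 * Real.pi * t / (2 * t + 1) with hθ
  have hnpos : (0 : ℝ) < 2 * t + 1 := by positivity
  have hθn : θ * (m + 2 : ℕ) = 2 * π * t := by rw [hnR, hθ, div_mul_cancel₀ _ hnpos.ne']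
  -- `θ = π − π/n`, so `2π/3 < θ < π`, `λ = 2cos θ < −1`, `sin 2θ ≠ 0`
  have hθeq : θ = π - π / (2 * t + 1) := by rw [hθ]; field_simp; ring
  have ht2 : (2 : ℝ) ≤ t := by exact_mod_cast ht
  have hθlt : θ < π := by
    rw [hθeq]
    have : 0 < π / (2 * t + 1) := div_pos Real.pi_pos hnpos
    linarith
  have hθgt : 2 * π / 3 < θ := by
    rw [hθeq, show 2 * π / 3 = π - π / 3 by ring]
    have : π / (2 * t + 1) < π / 3 := div_lt_div_of_pos_left Real.pi_pos (by norm_num) (by linarith)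
    linarith
  set lam : ℝ := 2 * Real.cos θ with hlam
  have hlam_lt : lam < -1 := by
    have : Real.cos θ < Real.cos (2 * π / 3) :=
      Real.cos_lt_cos_of_nonneg_of_le_pi (by positivity) hθlt.le hθgt
    rw [show 2 * π / 3 = π - π / 3 by ring, Real.cos_pi_sub, Real.cos_pi_div_three] at this
    rw [hlam]
    linarith
  have hsin2θ : Real.sin (2 * θ) ≠ 0 := by
    have h1 : Real.sin (2 * θ) = -Real.sin (2 * π / (2 * t + 1)) := by
      rw [hθeq, show 2 * (π - π / (2 * t + 1)) = -(2 * π / (2 * t + 1)) + (1 : ℕ) * (2 * π) by push_cast; ring,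
        Real.sin_add_nat_mul_two_pi, Real.sin_neg]
    have h2 : 0 < Real.sin (2 * π / (2 * t + 1)) := by
      apply Real.sin_pos_of_pos_of_lt_pi (by positivity)
      rw [div_lt_iff₀ hnpos]
      nlinarith [Real.pi_pos]
    rw [h1]
    linarith
  set X : Matrix (Fin (m + 2)) (Fin (m + 2)) ℝ := (SimpleGraph.cycleGraph (m + 2)).adjMatrix ℝ -
    lam • (1 : Matrix (Fin (m + 2)) (Fin (m + 2)) ℝ) with hXdef
  -- entries of `X`
  have hXapply : ∀ a b : Fin (m + 2), X a b =
      (if (SimpleGraph.cycleGraph (m + 2)).Adj a b then 1 else 0) - lam * (if a = b then 1 else 0) := by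
    intro a b
    rw [hXdef, Matrix.sub_apply, Matrix.smul_apply, Matrix.one_apply, SimpleGraph.adjMatrix_apply,
      smul_eq_mul]
  have hXdiag : ∀ a : Fin (m + 2), X a a = -lam := by
    intro a
    rw [hXapply, if_neg (SimpleGraph.irrefl _), if_pos rfl]
    ring
  have hXoff : ∀ a b : Fin (m + 2), a ≠ b → ¬ (SimpleGraph.cycleGraph (m + 2)).Adj a b → X a b = 0 := by
    intro a b hab hadj
    rw [hXapply, if_neg hadj, if_neg hab]
    ring
  have h01 : (SimpleGraph.cycleGraph (m + 2)).Adj 0 1 := by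
    rw [cycleGraph_adj_iff']
    exact Or.inr (by ring)
  have h10ne : (1 : Fin (m + 2)) ≠ 0 := by
    intro h
    have := congrArg Fin.val h
    rw [Fin.val_one, Fin.val_zero] at this
    omega
  have hX01 : X 0 1 = 1 := by
    rw [hXapply, if_pos h01, if_neg h10ne.symm]
    ring
  have hX10 : X 1 0 = 1 := by
    rw [hXapply, if_pos h01.symm, if_neg h10ne]
    ring
  intro hXd
  -- kernel vectors
  have hw : X *ᵥ (fun k : Fin (m + 2) => Real.sin (θ * k + -(2 * θ))) = 0 :=
    cycle_sub_mulVec_sin' hm1 θ (-(2 * θ)) t hθn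
  have hw' : X *ᵥ (fun k : Fin (m + 2) => Real.sin (θ * k + θ)) = 0 :=
    cycle_sub_mulVec_sin' hm1 θ θ t hθn
  have h2val : ((1 + 1 : Fin (m + 2)) : ℕ) = 2 := by
    rw [Fin.val_add, Fin.val_one, Nat.mod_eq_of_lt (by omega)]
  obtain ⟨c, _, hrow⟩ := hXd.exists_row_eq_mul_row hτ (i := 0) (j := 1) hw hw'
    (by -- `w_0 = sin(−2θ) ≠ 0`
      simp only [Fin.val_zero, Nat.cast_zero, mul_zero, zero_add, Real.sin_neg, neg_ne_zero]
      exact hsin2θ)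
    (by -- `w'_1 = sin(2θ) ≠ 0`
      simp only [Fin.val_one, Nat.cast_one, mul_one, show θ + θ = 2 * θ by ring]
      exact hsin2θ)
    (by -- other indices: `a = 2` has `w_2 = 0`, else `1 ≁ a`
      intro a ha0 ha1
      by_cases ha2 : a = 1 + 1
      · left
        show Real.sin (θ * ((a : ℕ) : ℝ) + -(2 * θ)) = 0
        rw [ha2, h2val, show θ * ((2 : ℕ) : ℝ) + -(2 * θ) = 0 by push_cast; ring, Real.sin_zero]
      · right
        refine hXoff 1 a (Ne.symm ha1) fun hadj => ?_
        rw [cycleGraph_adj_iff'] at hadj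
        rcases hadj with h | h
        · exact ha0 (by linear_combination (-1 : Fin (m + 2)) * h)
        · exact ha2 h)
    (by -- other indices: `a = −1` has `w'_a = sin(θn) = 0`, else `a ≁ 0`
      intro a ha0 ha1
      by_cases ha2 : a = -1
      · left
        show Real.sin (θ * ((a : ℕ) : ℝ) + θ) = 0
        rw [ha2, Fin.coe_neg_one, show θ * ((m + 1 : ℕ) : ℝ) + θ = θ * ((m + 2 : ℕ) : ℝ) by push_cast; ring,
          hθn, show 2 * π * (t : ℝ) = ((2 * t : ℕ) : ℝ) * π by push_cast; ring, Real.sin_nat_mul_pi]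
      · right
        refine hXoff a 0 ha0 fun hadj => ?_
        rw [cycleGraph_adj_iff'] at hadj
        rcases hadj with h | h
        · exact ha1 (by rw [h, zero_add])
        · exact ha2 (by linear_combination (-1 : Fin (m + 2)) * h))
    (by rw [hX01]; exact one_ne_zero)
  -- rows `0` and `1` proportional: `1 = c(−λ)` and `−λ = c`, so `λ² = 1`
  have h0 := hrow 0
  have h1 := hrow 1
  rw [hX10, hXdiag] at h0
  rw [hXdiag, hX01, mul_one] at h1
  rw [← h1] at h0
  nlinarith

/-- **PSVW Lemma 11, the `𝒩⁺`-clause for every tracial pair** (p20–p21, verbatim): "Let `A_t` denote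
the adjacency matrix of `C_{2t+1}` (`t ≥ 2`), and let `λ_t` be its least eigenvalue. The matrix
`A_t − λ_t I` … does not admit an `𝒩⁺`-factorization for any tracial von Neumann algebra `(𝒩, τ)`";
`λ_t = 2cos(2πt/(2t+1))` (proof, p21). Typed for every unital C⋆-algebra `A` with a faithful positive
trace `τ`. (For `(M_d(ℂ), Tr)`: `¬ IsCpsd`, `PrakashEtAl2017_lemma11_holds`.)
[cite: PrakashEtAl2017, Lemma 11 (p20–p21)] -/
theorem PrakashEtAl2017_lemma11_tracial (t : ℕ) (ht : 2 ≤ t) (τ : A →ₗ[ℂ] ℂ) (hτ : IsFaithfulTrace τ) :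
    ¬ HasTracialFactorization τ ((SimpleGraph.cycleGraph (2 * t + 1)).adjMatrix ℝ -
        (2 * Real.cos (2 * Real.pi * t / (2 * t + 1))) •
          (1 : Matrix (Fin (2 * t + 1)) (Fin (2 * t + 1)) ℝ)) := by
  obtain ⟨m, hm⟩ : ∃ m, 2 * t + 1 = m + 2 := ⟨2 * t - 1, by omega⟩
  rw [hm]
  exact lemma11_tracial_core m t ht hm.symm τ hτ

/-- **PSVW Lemma 11 in full, for a tracial pair `(A, τ)`**: `A_t − λ_t I` is doubly nonnegative
(`PrakashEtAl2017_lemma11_holds`) and admits no `A⁺`-factorization through `τ`.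
[cite: PrakashEtAl2017, Lemma 11 (p20–p21)] -/
theorem PrakashEtAl2017_lemma11_general (t : ℕ) (ht : 2 ≤ t) (τ : A →ₗ[ℂ] ℂ) (hτ : IsFaithfulTrace τ) :
    IsDnn ((SimpleGraph.cycleGraph (2 * t + 1)).adjMatrix ℝ -
        (2 * Real.cos (2 * Real.pi * t / (2 * t + 1))) •
          (1 : Matrix (Fin (2 * t + 1)) (Fin (2 * t + 1)) ℝ)) ∧
    ¬ HasTracialFactorization τ ((SimpleGraph.cycleGraph (2 * t + 1)).adjMatrix ℝ -
        (2 * Real.cos (2 * Real.pi * t / (2 * t + 1))) •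
          (1 : Matrix (Fin (2 * t + 1)) (Fin (2 * t + 1)) ℝ)) :=
  ⟨(PrakashEtAl2017_lemma11_holds t ht).1, PrakashEtAl2017_lemma11_tracial t ht τ hτ⟩

/-- **Lemma 11 for tracial von Neumann algebras**, the printed scope (`WStarAlgebra N`).
[cite: PrakashEtAl2017, Lemma 11 (p20–p21)] -/
theorem PrakashEtAl2017_lemma11_vonNeumann {N : Type*} [CStarAlgebra N] [WStarAlgebra N]
    [PartialOrder N] [StarOrderedRing N] (t : ℕ) (ht : 2 ≤ t) (τ : N →ₗ[ℂ] ℂ)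
    (hτ : IsFaithfulTrace τ) :
    ¬ HasTracialFactorization τ ((SimpleGraph.cycleGraph (2 * t + 1)).adjMatrix ℝ -
        (2 * Real.cos (2 * Real.pi * t / (2 * t + 1))) •
          (1 : Matrix (Fin (2 * t + 1)) (Fin (2 * t + 1)) ℝ)) :=
  PrakashEtAl2017_lemma11_tracial t ht τ hτ

end Lemma11

/-! ### The tracial pair `(M_d(ℂ), Tr)`: `CS_+`-factorizations are `A⁺`-factorizations -/

section MatrixAlgebra

open scoped MatrixOrder

variable (d : ℕ)

/-- The trace of `M_d(ℂ)` as a linear functional on Mathlib's C⋆-algebra of complex matrices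
`CStarMatrix (Fin d) (Fin d) ℂ` (the type synonym of `Matrix (Fin d) (Fin d) ℂ` carrying the operator
norm, the C⋆-algebra structure and its positive cone). PSVW §1.1/Definition 1 work in this tracial pair:
"`X_{ij} = Tr(P_i P_j)` … `P_i ∈ H^d_+`". [cite: PrakashEtAl2017, Def. 1 (p04), §6.1 (p20)] -/
def matrixTrace : CStarMatrix (Fin d) (Fin d) ℂ →ₗ[ℂ] ℂ :=
  (Matrix.traceLinearMap (Fin d) ℂ ℂ) ∘ₗ (CStarMatrix.ofMatrixₗ (R := ℂ)).symm.toLinearMap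

/-- `matrixTrace d (ofMatrix M) = Tr M`. [cite: PrakashEtAl2017, Def. 1 (p04)] -/
theorem matrixTrace_ofMatrix (M : Matrix (Fin d) (Fin d) ℂ) :
    matrixTrace d (CStarMatrix.ofMatrix M) = M.trace := rfl

/-- `(M_d(ℂ), Tr)` satisfies (i)–(iii): `Tr(x*x) ≥ 0`, `Tr(x*x) = 0 ⟹ x = 0`, `Tr(xy) = Tr(yx)` — the
tracial pair of `CS_+`-factorizations. [cite: PrakashEtAl2017, §6.1 (p19–p20), Def. 1 (p04)] -/
theorem isFaithfulTrace_matrixTrace : IsFaithfulTrace (matrixTrace d) where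
  nonneg x := by
    change (0 : ℂ) ≤ Matrix.trace ((CStarMatrix.ofMatrix.symm x)ᴴ * CStarMatrix.ofMatrix.symm x)
    exact (Matrix.posSemidef_conjTranspose_mul_self _).trace_nonneg
  faithful x hx := by
    change Matrix.trace ((CStarMatrix.ofMatrix.symm x)ᴴ * CStarMatrix.ofMatrix.symm x) = 0 at hx
    exact Matrix.trace_conjTranspose_mul_self_eq_zero_iff.mp hx
  tracial x y := by
    change Matrix.trace (CStarMatrix.ofMatrix.symm x * CStarMatrix.ofMatrix.symm y) =
      Matrix.trace (CStarMatrix.ofMatrix.symm y * CStarMatrix.ofMatrix.symm x)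
    exact Matrix.trace_mul_comm _ _

/-- A Hermitian psd matrix `P ∈ H^d_+` is a positive element of the C⋆-algebra `M_d(ℂ)` (`P = B*B`).
[cite: PrakashEtAl2017, §6.1 (p20: "`p` is called positive if `p = x*x`")] -/
theorem ofMatrix_nonneg_of_posSemidef {P : Matrix (Fin d) (Fin d) ℂ} (hP : P.PosSemidef) :
    (0 : CStarMatrix (Fin d) (Fin d) ℂ) ≤ CStarMatrix.ofMatrix P := by
  obtain ⟨B, hB⟩ := CStarAlgebra.nonneg_iff_eq_star_mul_self.mp hP.nonneg
  rw [hB]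
  exact star_mul_self_nonneg (CStarMatrix.ofMatrix B)

/-- For `d ≥ 1` the normalised trace `(1/d)·Tr` is a faithful tracial STATE on `M_d(ℂ)` — the
printed conditions (i)–(iii) including `τ(1) = 1`; so `(M_d(ℂ), d⁻¹Tr)` is a tracial von Neumann
algebra in PSVW's sense. [cite: PrakashEtAl2017, §6.1 (p19–p20)] -/
theorem isFaithfulTracialState_matrixTrace_normalised (hd : 0 < d) :
    IsFaithfulTracialState ((((d : ℝ)⁻¹ : ℝ) : ℂ) • matrixTrace d) where
  toIsFaithfulTrace := (isFaithfulTrace_matrixTrace d).smul (inv_pos.mpr (by exact_mod_cast hd))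
  map_one := by
    rw [LinearMap.smul_apply, smul_eq_mul]
    change (((d : ℝ)⁻¹ : ℝ) : ℂ) * Matrix.trace (1 : Matrix (Fin d) (Fin d) ℂ) = 1
    rw [Matrix.trace_one, Fintype.card_fin]
    have hd' : (d : ℂ) ≠ 0 := by exact_mod_cast hd.ne'
    push_cast
    exact inv_mul_cancel₀ hd'

/-- An `A⁺`-factorization through `Tr` is one through the normalised trace `d⁻¹Tr` (rescale the
factors by `√d`), so nothing is lost by the normalisation `τ(1) = 1`. [cite: PrakashEtAl2017, §6.1 (p19–p20)] -/
theorem HasTracialFactorization.smul_trace {ι : Type*} {τ : A →ₗ[ℂ] ℂ} {X : Matrix ι ι ℝ}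
    (h : HasTracialFactorization τ X) {r : ℝ} (hr : 0 < r) :
    HasTracialFactorization (((r : ℝ) : ℂ) • τ) X := by
  obtain ⟨p, hp, hX⟩ := h
  refine ⟨fun i => ((Real.sqrt r⁻¹ : ℝ) : ℂ) • p i, fun i => ?_, fun i j => ?_⟩
  · show 0 ≤ ((Real.sqrt r⁻¹ : ℝ) : ℂ) • p i
    rw [Complex.coe_smul]
    exact smul_nonneg (Real.sqrt_nonneg _) (hp i)
  · show ((X i j : ℝ) : ℂ) = (((r : ℝ) : ℂ) • τ) ((((Real.sqrt r⁻¹ : ℝ) : ℂ) • p i) * (((Real.sqrt r⁻¹ : ℝ) : ℂ) • p j))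
    rw [smul_mul_assoc, mul_smul_comm, smul_smul, LinearMap.smul_apply, map_smul, smul_eq_mul,
      smul_eq_mul, ← hX i j, ← mul_assoc, ← Complex.ofReal_mul, ← Complex.ofReal_mul,
      Real.mul_self_sqrt (inv_pos.mpr hr).le, mul_inv_cancel₀ hr.ne', Complex.ofReal_one, one_mul]

variable {d}

/-- **A `CS_+`-factorization of size `d` is an `A⁺`-factorization through `(M_d(ℂ), Tr)`** — the
tracial pair of `CompletelyPsdRank.lean` is an instance of the present setting.
[cite: PrakashEtAl2017, Def. 1 (p04), §6.1 (p20)] -/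
theorem HasCpsdFactorization.hasTracialFactorization_matrixTrace {ι : Type*} {X : Matrix ι ι ℝ}
    (h : HasCpsdFactorization X d) : HasTracialFactorization (matrixTrace d) X := by
  obtain ⟨P, hP, hX⟩ := h
  refine ⟨fun i => CStarMatrix.ofMatrix (P i), fun i => ofMatrix_nonneg_of_posSemidef d (hP i),
    fun i j => ?_⟩
  rw [hX i j]
  rfl

/-- Hence a matrix with no `A⁺`-factorization through `(M_d(ℂ), Tr)` for any `d` is not completely
positive semidefinite. [cite: PrakashEtAl2017, §6.1 (p20)] -/
theorem not_isCpsd_of_not_hasTracialFactorization_matrixTrace {ι : Type*} {X : Matrix ι ι ℝ}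
    (h : ∀ d : ℕ, ¬ HasTracialFactorization (matrixTrace d) X) : ¬ IsCpsd X :=
  fun ⟨d, hd⟩ => h d hd.hasTracialFactorization_matrixTrace

/-- The `CS_+` case of Lemma 11 RE-DERIVED from the tracial statement: `A_t − λ_t I` is not cpsd
(`t ≥ 2`) — the second conjunct of `PrakashEtAl2017_lemma11_holds`, now as the instance
`(A, τ) = (M_d(ℂ), Tr)` of `PrakashEtAl2017_lemma11_tracial`. [cite: PrakashEtAl2017, Lemma 11 (p20–p21), Remark 6.2 (p21)] -/
theorem PrakashEtAl2017_lemma11_not_isCpsd (t : ℕ) (ht : 2 ≤ t) :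
    ¬ IsCpsd ((SimpleGraph.cycleGraph (2 * t + 1)).adjMatrix ℝ -
        (2 * Real.cos (2 * Real.pi * t / (2 * t + 1))) •
          (1 : Matrix (Fin (2 * t + 1)) (Fin (2 * t + 1)) ℝ)) :=
  not_isCpsd_of_not_hasTracialFactorization_matrixTrace fun d =>
    PrakashEtAl2017_lemma11_tracial t ht (matrixTrace d) (isFaithfulTrace_matrixTrace d)

end MatrixAlgebra

end Literature.Combinatorics.Optimization
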